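import Literature.NumberTheory.EllipticCurves.KummerImageIsotropyProofs
import Mathlib.FieldTheory.Galois.Infinite
import HarnessLib

/-!
# Route `ResidualThetaTransportAtTwo` (RTT P6, item stmt-BirchSwinnertonDyer-23110, road T), H-PLUSDUAL brick (ISO-1a):
# the Kummer image is isotropic AT A LAYER — Poonen–Rains 2012 Prop. 4.8 / Cor. 4.6 for a CLOSED SUBGROUP `U ≤ Γ_F`

Width seat `bsd-wall-tp2-p2x-w2` g15 (cell `bsd-wall`), for the LEAD `bsd-wall-tp2-p2x` g12. HONEST FRAMING: THEOREMS ONLY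
(no definition, no named fact, no instance, no `sorry`); generic (any field `F` with `F̄/F` Galois, any elliptic `W/F`, any
closed subgroup `U ≤ Γ_F`); closes no item; BSD is NOT proved by any of this.

The tree's `kummerClass_cupProduct_kummerClass_eq_zero_holds` (`KummerImageIsotropyProofs.lean`) proves the isotropy of the
Kummer image of `E(F)/m` in `H¹(F, E[m])` for the Weil-pairing cup product — the cocycle computation of Poonen–Rains, Prop. 4.8
with Cor. 4.6, carried out with Silverman's Weil functions: `e_m(s_σ, σ t_τ) · b(στ) = b(σ) · σ b(τ)` for a locally constant
`μ_m`-valued `b` (`WeierstrassCurve.exists_mu_coboundary`). The `±`-Iwasawa theory at `2` (B. D. Kim 2007 §3.3, Prop. 3.15)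
needs the same statement for the points over the LAYERS `k_n` of the local cyclotomic tower, i.e. for the Kummer cocycles of an
open (closed) subgroup `U = Gal(F̄/k_n) ≤ Γ_F` and points `Q` with `mQ ∈ E(F̄)^U` only. The Weil-function identities of the
tree are pointwise in `σ` (`isWeilFunction_weilCob` asks only that `σ` fix `m²A`; `weilCob_mul` is unconditional), so the
computation restricts to `U` verbatim; the one global input, Hilbert 90 for `Γ_F`, is replaced by Hilbert 90 for `U`, i.e.
for the field `F̄^U` (`AlgEquiv.exists_smul_div_eq_of_isOpen` over the fixed field, through the Galois correspondence for
closed subgroups `InfiniteGalois.fixingSubgroup_fixedField`).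

## What is proved
* `exists_units_smul_div_eq_of_subgroup` — **Hilbert 90 on a closed subgroup `U ≤ Γ_F`**: a locally constant `1`-cocycle
  `f : U → F̄ˣ` (`f(gh) = g f(h) f(g)`) is `g ↦ g(x)/x`.
* **`exists_mu_coboundary_subgroup`** — for `U ≤ Γ_F` closed, `P₁, Q₂ ∈ E(F̄)` with `mP₁` and `m²Q₂` fixed by `U`: there is a
  locally constant `b : U → μ_m(F̄)` with `e_m(σP₁ − P₁, σ(τ(mQ₂) − mQ₂)) · b(στ) = b(σ) · σ b(τ)` for all `σ, τ ∈ U` — the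
  cup-product cocycle of the two Kummer cocycles ON `U` is a coboundary (Poonen–Rains Prop. 4.8 at the layer `F̄^U`).
* `exists_muCarrier_coboundary_subgroup` — the same for EVERY alternating biadditive `μ_n`-valued `e` on `E[n]` (a power of `e_n`),
  as a continuous `μ_n`-valued cochain `β : C(U, μ_n)`: `e(s_σ, σ t_τ) = val(σβ(τ) − β(στ) + β(σ))`.

References: [PoonenRains2012] Prop. 4.8, Cor. 4.6; [SilvermanAEC2009] III §8; [SerreLocalFields1979] X §1 Prop. 2; [BDKim2007] Prop. 3.15.
-/

-- the Theorems namespace of this sub repeats the summit name by design (D-0017 nested layout)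
set_option linter.dupNamespace false

noncomputable section

open scoped Classical Topology

universe u

namespace Summit.BirchSwinnertonDyer.BirchSwinnertonDyer.Theorems.SignedEC.LayerKummerIso

open Field WeierstrassCurve Literature.NumberTheory.EllipticCurves Literature.NumberTheory.GaloisRepresentations
open Literature.NumberTheory.GaloisRepresentations.DiscreteGaloisModule (mu MuCarrier)

/-! ## §1 Hilbert 90 on a closed subgroup of `Γ_F` -/

/-- **Hilbert 90 on a closed subgroup `U ≤ Γ_F`.** For `F̄/F` Galois, `U ≤ Γ_F` closed with fixed field `K' = F̄^U`
(so `U = Gal(F̄/K')`, `InfiniteGalois.fixingSubgroup_fixedField`), every locally constant `1`-cocycle `f : U → F̄ˣ`,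
`f(gh) = g f(h) · f(g)`, is a coboundary `f(g) = g(x)/x` — the tree's `AlgEquiv.exists_smul_div_eq_of_isOpen` for the
normal extension `F̄/K'`, transported along `Gal(F̄/K') ≅ U` (`IntermediateField.fixingSubgroupEquiv`; the restriction
`Gal(F̄/K') → Γ_F` is continuous for the Krull topologies: the subgroup fixing a finite-dimensional `E/F` contains the
subgroup fixing the compositum `K'E`). [cite: SerreLocalFields1979, X §1 Prop. 2] -/
theorem exists_units_smul_div_eq_of_subgroup {F : Type u} [Field F] [IsGalois F (AlgebraicClosure F)]
    (U : Subgroup (absoluteGaloisGroup F)) (hU : IsClosed (U : Set (absoluteGaloisGroup F)))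
    (f : U → (AlgebraicClosure F)ˣ) (hf : ∀ g h : U, f (g * h) = (g : absoluteGaloisGroup F) • f h * f g)
    (hlc : IsLocallyConstant f) :
    ∃ x : (AlgebraicClosure F)ˣ, ∀ g : U, (g : absoluteGaloisGroup F) • x / x = f g := by
  -- `U` as a closed subgroup of `Gal(F̄/F)` (the identity `toAlgEquiv`) and its fixed field `K'`
  let U' : Subgroup (AlgebraicClosure F ≃ₐ[F] AlgebraicClosure F) :=
    U.comap (absoluteGaloisGroup.toAlgEquiv F).symm.toMonoidHom
  have hmemU' : ∀ φ : AlgebraicClosure F ≃ₐ[F] AlgebraicClosure F,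
      φ ∈ U' ↔ (absoluteGaloisGroup.toAlgEquiv F).symm φ ∈ U := fun _ ↦ Iff.rfl
  have hU'cl : IsClosed (U' : Set (AlgebraicClosure F ≃ₐ[F] AlgebraicClosure F)) := hU
  let Uc : ClosedSubgroup (AlgebraicClosure F ≃ₐ[F] AlgebraicClosure F) := ⟨U', hU'cl⟩
  let K' : IntermediateField F (AlgebraicClosure F) := IntermediateField.fixedField U'
  have hfix : K'.fixingSubgroup = U' := InfiniteGalois.fixingSubgroup_fixedField Uc
  -- `Gal(F̄/K') → U`, `φ ↦ φ|_F`
  have hmem : ∀ φ : AlgebraicClosure F ≃ₐ[K'] AlgebraicClosure F,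
      (absoluteGaloisGroup.toAlgEquiv F).symm (φ.restrictScalars F) ∈ U := fun φ ↦ by
    rw [← hmemU', ← hfix, IntermediateField.mem_fixingSubgroup_iff]
    intro x hx
    exact φ.commutes ⟨x, hx⟩
  let ψ : (AlgebraicClosure F ≃ₐ[K'] AlgebraicClosure F) →* U :=
    { toFun := fun φ ↦ ⟨(absoluteGaloisGroup.toAlgEquiv F).symm (φ.restrictScalars F), hmem φ⟩
      map_one' := Subtype.ext (by rfl)
      map_mul' := fun _ _ ↦ Subtype.ext (by rfl) }
  have hψ : ∀ φ : AlgebraicClosure F ≃ₐ[K'] AlgebraicClosure F,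
      ((ψ φ : U) : absoluteGaloisGroup F) = (absoluteGaloisGroup.toAlgEquiv F).symm (φ.restrictScalars F) := fun _ ↦ rfl
  -- `ψ` is onto: `g ∈ U` fixes `K'`
  have hsurj : ∀ g : U, ∃ φ : AlgebraicClosure F ≃ₐ[K'] AlgebraicClosure F, ψ φ = g := fun g ↦ by
    have hg : absoluteGaloisGroup.toAlgEquiv F (g : absoluteGaloisGroup F) ∈ K'.fixingSubgroup := by
      rw [hfix, hmemU']
      exact g.2
    refine ⟨IntermediateField.fixingSubgroupEquiv K' ⟨_, hg⟩, Subtype.ext ?_⟩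
    rfl
  -- `ψ` is continuous (Krull topologies)
  have hψc : Continuous ψ := by
    refine continuous_of_continuousAt_one ψ ?_
    rw [ContinuousAt, map_one, nhds_induced, Filter.tendsto_comap_iff]
    change Filter.Tendsto (fun φ : AlgebraicClosure F ≃ₐ[K'] AlgebraicClosure F ↦
      (absoluteGaloisGroup.toAlgEquiv F).symm (φ.restrictScalars F)) (𝓝 1) (𝓝 1)
    intro s hs
    obtain ⟨E, hEfin, hEs⟩ := (krullTopology_mem_nhds_one_iff F (AlgebraicClosure F) s).1 hs
    -- the compositum `K'·E`, finite-dimensional over `K'`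
    let bE := Module.finBasis F E
    let S : Set (AlgebraicClosure F) := Set.range fun i ↦ ((bE i : E) : AlgebraicClosure F)
    haveI : Finite S := Set.finite_range _ |>.to_subtype
    have hSint : ∀ x ∈ S, IsIntegral K' x := fun x _ ↦ (Algebra.IsIntegral.isIntegral (R := F) x).tower_top
    let E' : IntermediateField K' (AlgebraicClosure F) := IntermediateField.adjoin K' S
    haveI : FiniteDimensional K' E' := IntermediateField.finiteDimensional_adjoin hSint
    rw [Filter.mem_map]
    refine (krullTopology_mem_nhds_one_iff K' (AlgebraicClosure F) _).2 ⟨E', inferInstance, fun φ hφ ↦ hEs ?_⟩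
    rw [SetLike.mem_coe, IntermediateField.mem_fixingSubgroup_iff] at hφ ⊢
    intro x hx
    -- `x = Σ cᵢ bᵢ`, and `φ` fixes the `bᵢ`
    have hb : ∀ i, φ ((bE i : E) : AlgebraicClosure F) = ((bE i : E) : AlgebraicClosure F) := fun i ↦
      hφ _ (IntermediateField.subset_adjoin K' S ⟨i, rfl⟩)
    have hxrepr := bE.sum_repr ⟨x, hx⟩
    have hx' : (∑ i, bE.repr ⟨x, hx⟩ i • ((bE i : E) : AlgebraicClosure F)) = x := by
      have h := congrArg (fun y : E ↦ (y : AlgebraicClosure F)) hxrepr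
      simpa only [IntermediateField.coe_sum, IntermediateField.coe_smul] using h
    change (φ.restrictScalars F) x = x
    calc (φ.restrictScalars F) x
        = (φ.restrictScalars F) (∑ i, bE.repr ⟨x, hx⟩ i • ((bE i : E) : AlgebraicClosure F)) := by rw [hx']
      _ = ∑ i, bE.repr ⟨x, hx⟩ i • ((bE i : E) : AlgebraicClosure F) := by
          rw [map_sum]
          exact Finset.sum_congr rfl fun i _ ↦ by rw [map_smul]; exact congrArg _ (hb i)
      _ = x := hx'
  -- the transported cocycle on `Gal(F̄/K')`
  let f' : (AlgebraicClosure F ≃ₐ[K'] AlgebraicClosure F) → (AlgebraicClosure F)ˣ := fun φ ↦ f (ψ φ)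
  have hsmul : ∀ (φ : AlgebraicClosure F ≃ₐ[K'] AlgebraicClosure F) (y : (AlgebraicClosure F)ˣ),
      φ • y = ((ψ φ : U) : absoluteGaloisGroup F) • y := fun φ y ↦ Units.ext rfl
  have hf' : ∀ g h, f' (g * h) = g • f' h * f' g := fun g h ↦ by
    change f (ψ (g * h)) = g • f (ψ h) * f (ψ g)
    rw [map_mul, hf, hsmul]
  have hopen : IsOpen {g | f' g = 1} := (hlc.isOpen_fiber 1).preimage hψc
  haveI : Normal K' (AlgebraicClosure F) := Normal.tower_top_of_normal F K' (AlgebraicClosure F)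
  obtain ⟨x, hx⟩ := AlgEquiv.exists_smul_div_eq_of_isOpen (K := K') (L := AlgebraicClosure F) f' hf' hopen
  refine ⟨x, fun g ↦ ?_⟩
  obtain ⟨φ, rfl⟩ := hsurj g
  rw [← hsmul, hx φ]

/-! ## §2 The coboundary identity on a subgroup, and its `μ_m`-normalisation -/

/-- **Poonen–Rains at a layer: the cup product of two `U`-Kummer cocycles is a coboundary on `U`.** Let `W/F` be elliptic,
`(m : F) ≠ 0`, `F̄/F` Galois, `U ≤ Γ_F` a CLOSED subgroup and `P₁, Q₂ ∈ E(F̄)` with `mP₁` and `m²Q₂` fixed by `U` (so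
`s_σ = σP₁ − P₁` and `t_τ = τ(mQ₂) − mQ₂` are the `U`-Kummer cocycles of the `U`-rational points `mP₁`, `m²Q₂`). Then there is a
locally constant `b : U → F̄` with `b(σ)^m = 1` and `e_m(s_σ, σ t_τ) · b(στ) = b(σ) · σ b(τ)` for all `σ, τ ∈ U`. Proof = the tree's
`exists_mu_coboundary` restricted to `U`: the Weil functions `g_σ = weilCob Q₂ σ`, `h_σ = weilCob (P₁ + Q₂) σ` are Weil functions
for `t_σ` as soon as `σ ∈ U` (`isWeilFunction_weilCob`), hence proportional, `h_σ = u_σ g_σ`; comparing their cocycle identities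
(`weilCob_mul`, valid for all `σ, τ`) gives `e_m(s_σ, σt_τ) u_{στ} = u_σ σ(u_τ)` on `U`; `u` is locally constant; `u^m` is a
`1`-cocycle of `U` with values in `F̄ˣ`, a coboundary by Hilbert 90 ON `U` (§1), which normalises `u` into `μ_m`.
[cite: PoonenRains2012, Prop. 4.8 and Cor. 4.6] [cite: SilvermanAEC2009, III §8] [cite: BDKim2007, Prop. 3.15] -/
theorem exists_mu_coboundary_subgroup {F : Type u} [Field F] [IsGalois F (AlgebraicClosure F)] {W : WeierstrassCurve F}
    [W.IsElliptic] {m : ℕ} (hm : (m : F) ≠ 0)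
    (U : Subgroup (absoluteGaloisGroup F)) (hU : IsClosed (U : Set (absoluteGaloisGroup F))) {P₁ Q₂ : W.geomPoints}
    (hP : ∀ σ : U, (σ : absoluteGaloisGroup F) • ((m : ℤ) • P₁) = (m : ℤ) • P₁)
    (hQ : ∀ σ : U, (σ : absoluteGaloisGroup F) • ((m : ℤ) • ((m : ℤ) • Q₂)) = (m : ℤ) • ((m : ℤ) • Q₂)) :
    ∃ b : U → AlgebraicClosure F, IsLocallyConstant b ∧ (∀ σ, b σ ^ m = 1) ∧
      ∀ σ τ : U, weilPairingFun hm ((σ : absoluteGaloisGroup F) • P₁ - P₁)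
          ((σ : absoluteGaloisGroup F) • ((τ : absoluteGaloisGroup F) • ((m : ℤ) • Q₂) - (m : ℤ) • Q₂)) * b (σ * τ) =
        b σ * (σ : absoluteGaloisGroup F) • b τ := by
  have hm0 : m ≠ 0 := fun h ↦ hm (by rw [h, Nat.cast_zero])
  -- torsion bookkeeping
  have hs0 : ∀ ρ : U, (m : ℤ) • ((ρ : absoluteGaloisGroup F) • P₁ - P₁) = 0 := fun ρ ↦ by
    rw [smul_sub, ← smul_zsmul_geomPoints W (m : ℤ) (ρ : absoluteGaloisGroup F) P₁, hP ρ, sub_self]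
  have ht0 : ∀ ρ : U, (m : ℤ) • ((ρ : absoluteGaloisGroup F) • ((m : ℤ) • Q₂) - (m : ℤ) • Q₂) = 0 := fun ρ ↦ by
    rw [smul_sub, ← smul_zsmul_geomPoints W (m : ℤ) (ρ : absoluteGaloisGroup F), hQ ρ, sub_self]
  -- `g_σ`, `h_σ` are Weil functions for `t_σ` (σ ∈ U)
  have hgW : ∀ ρ : U, IsWeilFunction W m ((ρ : absoluteGaloisGroup F) • ((m : ℤ) • Q₂) - (m : ℤ) • Q₂)
      (weilCob hm Q₂ (ρ : absoluteGaloisGroup F)) := fun ρ ↦ by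
    have h := isWeilFunction_weilCob hm Q₂ (ρ : absoluteGaloisGroup F) (hQ ρ)
    rwa [zsmul_smul_sub] at h
  have hhW : ∀ ρ : U, IsWeilFunction W m ((ρ : absoluteGaloisGroup F) • ((m : ℤ) • Q₂) - (m : ℤ) • Q₂)
      (weilCob hm (P₁ + Q₂) (ρ : absoluteGaloisGroup F)) := fun ρ ↦ by
    have hfixA : (ρ : absoluteGaloisGroup F) • ((m : ℤ) • ((m : ℤ) • (P₁ + Q₂))) = (m : ℤ) • ((m : ℤ) • (P₁ + Q₂)) := by
      have h1 : (ρ : absoluteGaloisGroup F) • ((m : ℤ) • ((m : ℤ) • P₁)) = (m : ℤ) • ((m : ℤ) • P₁) := by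
        rw [smul_zsmul_geomPoints W (m : ℤ) (ρ : absoluteGaloisGroup F), hP ρ]
      rw [smul_add, smul_add, smul_add, h1, hQ ρ]
    have h := isWeilFunction_weilCob hm (P₁ + Q₂) (ρ : absoluteGaloisGroup F) hfixA
    have e : (m : ℤ) • ((ρ : absoluteGaloisGroup F) • (P₁ + Q₂) - (P₁ + Q₂)) =
        (ρ : absoluteGaloisGroup F) • ((m : ℤ) • Q₂) - (m : ℤ) • Q₂ := by
      rw [show (ρ : absoluteGaloisGroup F) • (P₁ + Q₂) - (P₁ + Q₂) =
          ((ρ : absoluteGaloisGroup F) • P₁ - P₁) + ((ρ : absoluteGaloisGroup F) • Q₂ - Q₂) by rw [smul_add]; abel,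
        smul_add, hs0 ρ, zero_add, zsmul_smul_sub]
    rwa [e] at h
  -- the comparison constants `u_ρ`: `h_ρ = u_ρ g_ρ`
  choose u hu0 hu using fun ρ : U ↦ (hgW ρ).exists_eq_mul (hhW ρ)
  have hg0 : ∀ ρ : absoluteGaloisGroup F, weilCob hm Q₂ ρ ≠ 0 := fun ρ ↦ weilCob_ne_zero hm Q₂ ρ
  -- the coboundary identity `e(s_σ, σ t_τ) u_{στ} = u_σ σ(u_τ)` for `σ, τ ∈ U`
  have hI : ∀ σ τ : U, weilPairingFun hm ((σ : absoluteGaloisGroup F) • P₁ - P₁)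
      ((σ : absoluteGaloisGroup F) • ((τ : absoluteGaloisGroup F) • ((m : ℤ) • Q₂) - (m : ℤ) • Q₂)) * u (σ * τ) =
      u σ * (σ : absoluteGaloisGroup F) • u τ := by
    intro σ τ
    set σ' : absoluteGaloisGroup F := (σ : absoluteGaloisGroup F) with hσ'
    set τ' : absoluteGaloisGroup F := (τ : absoluteGaloisGroup F) with hτ'
    have hστ' : ((σ * τ : U) : absoluteGaloisGroup F) = σ' * τ' := rfl
    set C := algebraMap (AlgebraicClosure F) W.geomFunctionField with hC
    set s : W.geomPoints := σ' • P₁ - P₁ with hs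
    set x : W.geomPoints := σ' • Q₂ - Q₂ with hx
    set t : absoluteGaloisGroup F → W.geomPoints := fun ρ ↦ ρ • ((m : ℤ) • Q₂) - (m : ℤ) • Q₂ with ht
    set g : absoluteGaloisGroup F → W.geomFunctionField := fun ρ ↦ weilCob hm Q₂ ρ with hg
    set h : absoluteGaloisGroup F → W.geomFunctionField := fun ρ ↦ weilCob hm (P₁ + Q₂) ρ with hh
    have hBg : g (σ' * τ') = g σ' * W.transAlgHom (-x) (W.galFunctionField σ' (g τ')) := weilCob_mul hm Q₂ σ' τ'
    have hBh : h (σ' * τ') = h σ' * W.transAlgHom (-s) (W.transAlgHom (-x) (W.galFunctionField σ' (h τ'))) := by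
      have hraw := weilCob_mul hm (P₁ + Q₂) σ' τ'
      have eneg : -(σ' • (P₁ + Q₂) - (P₁ + Q₂)) = -(σ' • P₁ - P₁) + -(σ' • Q₂ - Q₂) := by rw [smul_add]; abel
      rw [eneg, ← transAlgHom_transAlgHom] at hraw
      exact hraw
    have hhuσ : h σ' = C (u σ) * g σ' := hu σ
    have hhuτ : h τ' = C (u τ) * g τ' := hu τ
    have hhuστ : h (σ' * τ') = C (u (σ * τ)) * g (σ' * τ') := hu (σ * τ)
    have htmul : t (σ' * τ') = t σ' + σ' • t τ' := mul_smul_sub_eq σ' τ' _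
    have hgWσ : IsWeilFunction W m (t σ') (g σ') := hgW σ
    have hgWστ : IsWeilFunction W m (t (σ' * τ')) (g (σ' * τ')) := hgW (σ * τ)
    have ht0σ : (m : ℤ) • t σ' = 0 := ht0 σ
    have ht0στ : (m : ℤ) • t (σ' * τ') = 0 := ht0 (σ * τ)
    change weilPairingFun hm s (σ' • t τ') * u (σ * τ) = u σ * σ' • u τ
    have hs0' : (m : ℤ) • s = 0 := hs0 σ
    have hns0 : (m : ℤ) • (-s) = 0 := by rw [smul_neg, hs0', neg_zero]
    have hσt0 : (m : ℤ) • (σ' • t τ') = 0 := by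
      rw [← smul_zsmul_geomPoints W (m : ℤ) σ', ht0 τ, smul_zero]
    -- the key function `k` and its translate by `-s`
    set k : W.geomFunctionField := W.transAlgHom (-x) (W.galFunctionField σ' (g τ')) with hk
    set e₁ := weilPairingFun hm (-s) (t (σ' * τ')) with he₁
    set e₂ := weilPairingFun hm (-s) (t σ') with he₂
    have hE1 : W.transAlgHom (-s) (g (σ' * τ')) = C e₁ * g (σ' * τ') := hgWστ.transAlgHom_eq hm hns0 ht0στ
    have hE2 : W.transAlgHom (-s) (g σ') = C e₂ * g σ' := hgWσ.transAlgHom_eq hm hns0 ht0σ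
    have hE5 : C e₂ * g σ' * W.transAlgHom (-s) k = C e₁ * (g σ' * k) := by
      rw [← hBg, ← hE1, hBg, map_mul, hE2]
    -- `h (στ)` computed in two ways
    have hway1 : h (σ' * τ') = C (u (σ * τ)) * (g σ' * k) := by rw [hhuστ, hBg]
    have hway2 : h (σ' * τ') = C (u σ) * g σ' * (C (σ' • u τ) * W.transAlgHom (-s) k) := by
      rw [hBh, hhuσ, hhuτ, map_mul, galFunctionField_algebraMap_base, galRingHom_apply, map_mul,
        AlgHom.commutes, map_mul, AlgHom.commutes]
    have hprod : C (e₂ * u (σ * τ)) * (g σ' * k) = C (u σ * σ' • u τ * e₁) * (g σ' * k) := by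
      have e := congrArg (fun z ↦ C e₂ * z) (hway1.symm.trans hway2)
      calc C (e₂ * u (σ * τ)) * (g σ' * k) = C e₂ * (C (u (σ * τ)) * (g σ' * k)) := by
            rw [map_mul]; ring
        _ = C e₂ * (C (u σ) * g σ' * (C (σ' • u τ) * W.transAlgHom (-s) k)) := e
        _ = C (u σ) * C (σ' • u τ) * (C e₂ * g σ' * W.transAlgHom (-s) k) := by ring
        _ = C (u σ) * C (σ' • u τ) * (C e₁ * (g σ' * k)) := by rw [hE5]
        _ = C (u σ * σ' • u τ * e₁) * (g σ' * k) := by rw [map_mul, map_mul]; ring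
    have hgk0 : g σ' * k ≠ 0 := by
      refine mul_ne_zero (hg0 σ') ?_
      exact (map_ne_zero_iff _ (W.transAlgHom (-x)).injective).mpr
        ((map_ne_zero_iff _ (W.galFunctionField σ').injective).mpr (hg0 τ'))
    have hconst : e₂ * u (σ * τ) = u σ * σ' • u τ * e₁ := algebraMap_mul_cancel hgk0 hprod
    -- `e₁ = e₂ · e(-s, σ t_τ)` and `e(s, ·) e(-s, ·) = 1`
    have he12 : e₁ = e₂ * weilPairingFun hm (-s) (σ' • t τ') := by
      rw [he₁, htmul, weilPairingFun_add_right hm hns0 ht0σ hσt0]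
    have he2ne : e₂ ≠ 0 := weilPairingFun_ne_zero hm hns0 ht0σ
    have hu' : u (σ * τ) = u σ * σ' • u τ * weilPairingFun hm (-s) (σ' • t τ') := by
      apply mul_left_cancel₀ he2ne
      rw [hconst, he12]; ring
    have hinv := weilPairingFun_mul_neg_left hm hs0' hσt0
    rw [hu']
    calc weilPairingFun hm s (σ' • t τ') * (u σ * σ' • u τ * weilPairingFun hm (-s) (σ' • t τ'))
          = u σ * σ' • u τ * (weilPairingFun hm s (σ' • t τ') * weilPairingFun hm (-s) (σ' • t τ')) := by
            ring
      _ = u σ * σ' • u τ := by rw [hinv, mul_one]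
  -- `u` is locally constant on `U`
  have hulc : IsLocallyConstant u := by
    have hpair : IsLocallyConstant (fun ρ : U ↦ (weilCob hm Q₂ (ρ : absoluteGaloisGroup F),
        weilCob hm (P₁ + Q₂) (ρ : absoluteGaloisGroup F))) :=
      ((isLocallyConstant_weilCob hm Q₂).prodMk (isLocallyConstant_weilCob hm (P₁ + Q₂))).comp_continuous
        continuous_subtype_val
    rw [IsLocallyConstant.iff_exists_open] at hpair ⊢
    intro ρ₀
    obtain ⟨V, hV, hρ₀, hconst⟩ := hpair ρ₀
    refine ⟨V, hV, hρ₀, fun ρ hρ ↦ ?_⟩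
    have hc := hconst ρ hρ
    simp only [Prod.mk.injEq] at hc
    obtain ⟨h1, h2⟩ := hc
    have e1 := hu ρ
    rw [h1, h2, hu ρ₀] at e1
    exact (algebraMap_mul_cancel (hg0 _) e1).symm
  -- the cup-product values are `m`-th roots of unity
  have hepow : ∀ σ τ : U, weilPairingFun hm ((σ : absoluteGaloisGroup F) • P₁ - P₁)
      ((σ : absoluteGaloisGroup F) • ((τ : absoluteGaloisGroup F) • ((m : ℤ) • Q₂) - (m : ℤ) • Q₂)) ^ m = 1 := by
    intro σ τ
    refine weilPairingFun_pow hm (hs0 σ) ?_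
    rw [← smul_zsmul_geomPoints W (m : ℤ) (σ : absoluteGaloisGroup F), ht0 τ, smul_zero]
  -- `σ ↦ u_σ^m` as a units-valued cocycle of `U`; Hilbert 90 on `U`
  let Φ : AlgebraicClosure F → (AlgebraicClosure F)ˣ := fun a ↦ if ha : a = 0 then 1 else Units.mk0 a ha ^ m
  set f : U → (AlgebraicClosure F)ˣ := fun ρ ↦ Φ (u ρ) with hf
  have hfval : ∀ ρ, ((f ρ : (AlgebraicClosure F)ˣ) : AlgebraicClosure F) = u ρ ^ m := fun ρ ↦ by
    simp only [hf, Φ, dif_neg (hu0 ρ), Units.val_pow_eq_pow_val, Units.val_mk0]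
  have hflc : IsLocallyConstant f := hulc.comp Φ
  have hsm : ∀ (g : absoluteGaloisGroup F) (z : (AlgebraicClosure F)ˣ),
      ((g • z : (AlgebraicClosure F)ˣ) : AlgebraicClosure F) = g • (z : AlgebraicClosure F) := fun g z ↦ rfl
  have hfcoc : ∀ g h : U, f (g * h) = (g : absoluteGaloisGroup F) • f h * f g := by
    intro g h
    apply Units.ext
    rw [Units.val_mul, hsm, hfval, hfval, hfval, smul_pow']
    have e := congrArg (fun z ↦ z ^ m) (hI g h)
    simp only [mul_pow, hepow, one_mul] at e
    rw [e, mul_comm]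
  obtain ⟨x, hx⟩ := exists_units_smul_div_eq_of_subgroup U hU f hfcoc hflc
  have hxval : ∀ g : U, (g : absoluteGaloisGroup F) • ((x : (AlgebraicClosure F)ˣ) : AlgebraicClosure F) / x = u g ^ m :=
    fun g ↦ by
    have e := congrArg (fun z : (AlgebraicClosure F)ˣ ↦ (z : AlgebraicClosure F)) (hx g)
    simp only [Units.val_div_eq_div_val, hfval] at e
    rw [← e, hsm]
  have hx0 : ((x : (AlgebraicClosure F)ˣ) : AlgebraicClosure F) ≠ 0 := x.ne_zero
  -- an `m`-th root `y` of `x`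
  obtain ⟨y, hy⟩ := IsAlgClosed.exists_pow_nat_eq ((x : (AlgebraicClosure F)ˣ) : AlgebraicClosure F) (Nat.pos_of_ne_zero hm0)
  have hy0 : y ≠ 0 := fun h0 ↦ hx0 (by rw [← hy, h0, zero_pow hm0])
  have hgy0 : ∀ g : absoluteGaloisGroup F, g • y ≠ 0 := fun g h0 ↦ hy0 (by
    rw [smul_eq_zero_iff_eq] at h0
    exact h0)
  have hgx0 : ∀ g : absoluteGaloisGroup F,
      g • ((x : (AlgebraicClosure F)ˣ) : AlgebraicClosure F) ≠ 0 := fun g h0 ↦ hx0 (by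
    rw [smul_eq_zero_iff_eq] at h0
    exact h0)
  refine ⟨fun g ↦ u g * y / (g : absoluteGaloisGroup F) • y, ?_, fun g ↦ ?_, fun g h ↦ ?_⟩
  · exact (hulc.prodMk ((isLocallyConstant_smul_algebraicClosure y).comp_continuous continuous_subtype_val)).comp
      fun p : AlgebraicClosure F × AlgebraicClosure F ↦ p.1 * y / p.2
  · have hxg := hxval g
    have hgx := hgx0 g
    rw [div_pow, mul_pow, ← smul_pow', hy, ← hxval g]
    field_simp
  · have e := hI g h
    have hgy := hgy0 g
    have hghy : (g : absoluteGaloisGroup F) • (h : absoluteGaloisGroup F) • y ≠ 0 := by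
      rw [← mul_smul]; exact hgy0 _
    beta_reduce
    rw [show (((g * h : U) : absoluteGaloisGroup F)) = (g : absoluteGaloisGroup F) * (h : absoluteGaloisGroup F) from rfl,
      mul_smul]
    have h1 : (g : absoluteGaloisGroup F) • (u h * y / (h : absoluteGaloisGroup F) • y) =
        (g : absoluteGaloisGroup F) • u h * (g : absoluteGaloisGroup F) • y /
          (g : absoluteGaloisGroup F) • (h : absoluteGaloisGroup F) • y := by
      rw [div_eq_mul_inv, div_eq_mul_inv, smul_mul', smul_mul', smul_inv'']
    rw [h1]
    set E₀ := weilPairingFun hm ((g : absoluteGaloisGroup F) • P₁ - P₁)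
      ((g : absoluteGaloisGroup F) • ((h : absoluteGaloisGroup F) • ((m : ℤ) • Q₂) - (m : ℤ) • Q₂)) with hE₀
    calc E₀ * (u (g * h) * y / (g : absoluteGaloisGroup F) • (h : absoluteGaloisGroup F) • y)
          = (E₀ * u (g * h)) * y / (g : absoluteGaloisGroup F) • (h : absoluteGaloisGroup F) • y := by ring
      _ = u g * (g : absoluteGaloisGroup F) • u h * y / (g : absoluteGaloisGroup F) • (h : absoluteGaloisGroup F) • y := by
          rw [e]
      _ = u g * (g : absoluteGaloisGroup F) • u h * y * (g : absoluteGaloisGroup F) • y /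
            ((g : absoluteGaloisGroup F) • (h : absoluteGaloisGroup F) • y * (g : absoluteGaloisGroup F) • y) :=
          (mul_div_mul_right _ _ hgy).symm
      _ = u g * y / (g : absoluteGaloisGroup F) • y *
            ((g : absoluteGaloisGroup F) • u h * (g : absoluteGaloisGroup F) • y /
              (g : absoluteGaloisGroup F) • (h : absoluteGaloisGroup F) • y) := by
          rw [div_mul_div_comm]; ring

/-! ## §3 Every alternating pairing on `E[n]`: a `μ_n`-valued continuous coboundary on `U` -/

/-- **The cup-product cocycle of two `U`-Kummer cocycles is the coboundary of a continuous `μ_n`-valued cochain ON `U`**, for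
EVERY alternating biadditive `μ_n`-valued pairing `e` on `E[n]` (each is a power `e_n^c` of the Weil pairing,
`exists_pairing_eq_weilPairingFun_pow`): for `U ≤ Γ_F` closed and `Q₁, Q₂ ∈ E(F̄)` with `nQ₁, nQ₂` fixed by `U` there is
`β : C(U, μ_n)` with `e(s_σ, σ t_τ) = val(σβ(τ) − β(στ) + β(σ))` for all `σ, τ ∈ U` and all torsion points `s_σ`, `σt_τ` with
underlying points `σQ₁ − Q₁`, `σ(τQ₂ − Q₂)` (Poonen–Rains Prop. 4.8 / Cor. 4.6 at the layer `F̄^U`). This is the input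
`hβ` of `ShapiroCup.cupProduct_shapiroCocycle_eq_zero_of_coboundary` for the Kummer cocycles of a layer.
[cite: PoonenRains2012, Prop. 4.8 and Cor. 4.6] [cite: BDKim2007, Prop. 3.15] -/
theorem exists_muCarrier_coboundary_subgroup {F : Type u} [Field F] [IsGalois F (AlgebraicClosure F)]
    {W : WeierstrassCurve F} [W.IsElliptic] {n : ℕ} [NeZero n] (hnF : (n : F) ≠ 0)
    (e : geomTorsion W n → geomTorsion W n → AlgebraicClosure F)
    (hμ : ∀ S T, e S T ^ n = 1) (hadd₁ : ∀ S₁ S₂ T, e (S₁ + S₂) T = e S₁ T * e S₂ T)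
    (hadd₂ : ∀ S T₁ T₂, e S (T₁ + T₂) = e S T₁ * e S T₂) (halt : ∀ T, e T T = 1)
    (U : Subgroup (absoluteGaloisGroup F)) (hU : IsClosed (U : Set (absoluteGaloisGroup F))) (Q₁ Q₂ : W.geomPoints)
    (hQ₁ : ∀ σ : U, (σ : absoluteGaloisGroup F) • ((n : ℤ) • Q₁) = (n : ℤ) • Q₁)
    (hQ₂ : ∀ σ : U, (σ : absoluteGaloisGroup F) • ((n : ℤ) • Q₂) = (n : ℤ) • Q₂) :
    ∃ β : C(U, MuCarrier F n), ∀ (σ τ : U) (S T : geomTorsion W n),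
      (S : W.geomPoints) = (σ : absoluteGaloisGroup F) • Q₁ - Q₁ →
      (T : W.geomPoints) = (σ : absoluteGaloisGroup F) • ((τ : absoluteGaloisGroup F) • Q₂ - Q₂) →
      e S T = muFieldVal ((mu F n).toTopRep.ρ (σ : absoluteGaloisGroup F) (β τ) - β (σ * τ) + β σ) := by
  have hn0 : n ≠ 0 := NeZero.ne n
  have hnZ : (n : ℤ) ≠ 0 := intCast_ne_zero_of_natCast_ne_zero hnF
  -- (1) `e` is a power of the Weil pairing
  obtain ⟨c, hc⟩ := exists_pairing_eq_weilPairingFun_pow hnF e hμ hadd₁ hadd₂ halt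
  -- (2) an `n`-th root `Q₂'` of `Q₂` and the `μ_n`-valued cochain `b` on `U`
  obtain ⟨Q₂', hQ₂'⟩ := zsmul_geomPoints_surjective_holds W hnZ Q₂
  change (n : ℤ) • Q₂' = Q₂ at hQ₂'
  subst hQ₂'
  obtain ⟨b, hblc, hbn, hbI⟩ := exists_mu_coboundary_subgroup hnF U hU hQ₁ hQ₂
  have hb0 : ∀ σ, b σ ≠ 0 := fun σ h0 ↦ by
    have := hbn σ
    rw [h0, zero_pow hn0] at this
    exact zero_ne_one this
  have hbcn : ∀ σ, (b σ ^ c) ^ n = 1 := fun σ ↦ by rw [← pow_mul, mul_comm, pow_mul, hbn, one_pow]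
  have hbclc : IsLocallyConstant fun σ ↦ muOfFieldVal n (b σ ^ c) := hblc.comp fun a ↦ muOfFieldVal n (a ^ c)
  let β : C(U, MuCarrier F n) := ⟨fun σ ↦ muOfFieldVal n (b σ ^ c), hbclc.continuous⟩
  have hβ : ∀ σ, muFieldVal (β σ) = b σ ^ c := fun σ ↦ muFieldVal_muOfFieldVal (hbcn σ)
  refine ⟨β, fun σ τ S T hS hT ↦ ?_⟩
  -- both sides as elements of `F̄`
  rw [hc, hS, hT]
  have hR : muFieldVal ((mu F n).toTopRep.ρ (σ : absoluteGaloisGroup F) (β τ) - β (σ * τ) + β σ) =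
      (σ : absoluteGaloisGroup F) • (b τ ^ c) / b (σ * τ) ^ c * b σ ^ c := by
    rw [muFieldVal_add, muFieldVal_sub, hβ, hβ]
    change muFieldVal (mu F n (σ : absoluteGaloisGroup F) (β τ)) / _ * _ = _
    rw [muFieldVal_mu_apply, hβ]
  rw [hR]
  have hI := congrArg (fun z ↦ z ^ c) (hbI σ τ)
  simp only [mul_pow, ← smul_pow'] at hI
  have hne : b (σ * τ) ^ c ≠ 0 := pow_ne_zero _ (hb0 _)
  field_simp
  linear_combination hI

end Summit.BirchSwinnertonDyer.BirchSwinnertonDyer.Theorems.SignedEC.LayerKummerIso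

end
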